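import Literature.NumberTheory.EllipticCurves.BinaryQuarticPadicTubeFunctionProofs
import Literature.NumberTheory.EllipticCurves.BinaryQuarticPadicOrbitSumProofs
import Literature.NumberTheory.EllipticCurves.BinaryQuarticPadicIntegralRepresentativesProofs
import Literature.NumberTheory.EllipticCurves.BhargavaShankarLocalMassesProofs
import Literature.NumberTheory.EllipticCurves.BhargavaShankarSievePhiMeasurableProofs
import Literature.NumberTheory.EllipticCurves.BhargavaShankarCongruenceTypeCountProofs
import HarnessLib

/-!
# Bhargava–Shankar, Prop. 5.12 (= Prop. 3.13 published): the local density of the `2`-Selmer sieve,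
# `∫_{V_{ℤ_p}} φ_p(f) df = |2¹⁰/3³|_p · M_p(V,F)`

`Proofs` companion (theorems only: no definitions, no named facts). Source: M. Bhargava, A. Shankar,
*Binary quartic forms having bounded invariants, and the boundedness of the average rank of elliptic
curves*, Ann. of Math. (2) 181 (2015) 191–242; Prop. 5.12 of the held arXiv text `arXiv:1006.1002v2`
("`μ_p(S^F) = |2¹⁰/3³|_p · M_p(V,F)`", proof p. 33) in the weighted form of the published version
(Props. 3.6, 3.9, 3.11–3.13, proof of Thm 3.19: the `p`-adic integral of
`φ_p(f) = 1_{f ℚ_p-soluble} · 1_{(I(f),J(f)) ∈ 2⁴F_p^{inv} × 2⁶F_p^{inv}} / m_p(f)`).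

For the family `F` of all elliptic curves (`F_p^{inv} = invariantPairsAdic p`, `M_p(V,F) = localMassV p`)
this file proves, for every prime `p`,

  `∫_{V_{ℤ_p}} φ_p(f) dμ_p(f) = |2¹⁰/3³|_p · localMassV p`        (`integral_sievePhi_eq`)

— exactly the hypothesis `(F)` of `BinaryQuartic.averageRankLE_three_halves_of_localIntegrals`
(`BhargavaShankarCongruenceTypeCountProofs.lean`), whence **Cor. 1.2**: the named fact
`Literature.NumberTheory.EllipticCurves.averageRankLE_three_halves` of `BSDWave0.lean` (bsd.S26) is
discharged at the end of this file (`averageRankLE_three_halves_holds`, §4). The printed argument for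
(F), as assembled here:

1. `∫ φ_p = ∫⁻ Φ` with `Φ = 1_{Δ ≠ 0} φ_p` in `[0, ∞]` (`{Δ = 0}` is null; `m_p ≥ 1` off it);
2. the orbit form of the `p`-adic change of measure (Props. 3.11–3.12,
   `BinaryQuartic.lintegral_eq_mul_lintegral_tsum_orbits`):
   `∫⁻ Φ = (1 − p⁻²)|1/27|_p ∫⁻_{(I,J)} Σ_{orbits 𝒪, (I,J)(𝒪) = (I,J)} Φ(𝒪)/#Aut_{ℤ_p}(𝒪)`;
3. fibrewise, the orbit sum is `1_{(I,J) ∈ 2⁴F_p^{inv} × 2⁶F_p^{inv}}` times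
   `Σ_𝒪 1_{soluble}/(m_p · #Aut_{ℤ_p}) = #(E_{I,J}/2E_{I,J})/#E_{I,J}[2](ℚ_p)` (Cor. 3.8 and
   Lemmas 5.10–5.11, `BinaryQuartic.tsum_orbits_eq_localSelmerRatio`, the soluble classes having
   integral representatives by the minimisation lemmas,
   `BinaryQuartic.exists_integral_pgl2Equiv_of_mem_invariantPairsAdic`), which by Lemma 5.16
   (Brumer–Kramer) is the constant `c_p` (`c₂ = 2`, else `1`) off a null set;
4. `vol(2⁴F_p^{inv} × 2⁶F_p^{inv}) = |2¹⁰|_p vol(F_p^{inv})` (scaling of Haar measure), and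
   `M_p(V,F) = (1 − p⁻²) c_p vol(F_p^{inv})` (`localMassV_eq`), so that both sides equal
   `(1 − p⁻²) |2¹⁰/3³|_p c_p vol(F_p^{inv})` ("Note that we have the factor `2¹⁰·2/27` instead of
   `2/27` because `f ∈ B_p^{I,J}` has invariants `2⁴I` and `2⁶J` as opposed to `I` and `J`").

## References

* M. Bhargava, A. Shankar, Ann. of Math. (2) 181 (2015) 191–242, Prop. 5.12 and its proof
  (arXiv:1006.1002v2 numbering); Props. 3.6, 3.9, 3.11–3.13 and proof of Thm 3.19 (published
  numbering). [cite: BhargavaShankarAnnals2015, Prop. 5.12 (arXiv:1006.1002v2 numbering) = Prop. 3.13 (published numbering)]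
-/

noncomputable section

open scoped Classical ENNReal NNReal
open MulAction Set MeasureTheory Filter Literature.MeasureTheory.Group

namespace Literature.NumberTheory.EllipticCurves

namespace BinaryQuartic

open scoped IntegralAction

variable (p : ℕ) [Fact p.Prime]

/-! ## §1 The scaled invariant set `2⁴F_p^{inv} × 2⁶F_p^{inv}` and its volume -/

/-- The invariant condition of `φ_p` is membership of `(I(f), J(f))` in the scaled invariant set.
[cite: BhargavaShankarAnnals2015, proof of Thm 3.19 (published numbering)] -/
theorem exists_invariantPairsAdic_iff_invPair_mem (f : BinaryQuartic ℤ_[p]) :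
    (∃ IJ ∈ invariantPairsAdic p, f.I = 2 ^ 4 * IJ.1 ∧ f.J = 2 ^ 6 * IJ.2) ↔
      invPair f ∈ (fun IJ : ℤ_[p] × ℤ_[p] ↦ ((2 : ℤ_[p]) ^ 4 * IJ.1, (2 : ℤ_[p]) ^ 6 * IJ.2)) '' invariantPairsAdic p := by
  simp only [mem_image, invPair, Prod.mk.injEq]
  constructor
  · rintro ⟨IJ, hIJ, h1, h2⟩; exact ⟨IJ, hIJ, h1.symm, h2.symm⟩
  · rintro ⟨IJ, hIJ, h1, h2⟩; exact ⟨IJ, hIJ, h1.symm, h2.symm⟩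

/-- The scaled invariant set is measurable (it is clopen). [folklore] -/
theorem measurableSet_image_invariantPairsAdic :
    MeasurableSet ((fun IJ : ℤ_[p] × ℤ_[p] ↦ ((2 : ℤ_[p]) ^ 4 * IJ.1, (2 : ℤ_[p]) ^ 6 * IJ.2)) '' invariantPairsAdic p) :=
  (isClopen_image_invariantPairsAdic p).isOpen.measurableSet

/-- **Scaling of Haar measure on `ℤ_p²`**: `vol(2⁴S × 2⁶S-image) = |2⁴|_p |2⁶|_p vol(S)`. [folklore] -/
theorem volume_image_scale (S : Set (ℤ_[p] × ℤ_[p])) :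
    volume ((fun IJ : ℤ_[p] × ℤ_[p] ↦ ((2 : ℤ_[p]) ^ 4 * IJ.1, (2 : ℤ_[p]) ^ 6 * IJ.2)) '' S) =
      (‖(2 : ℤ_[p]) ^ 4‖₊ : ℝ≥0∞) * (‖(2 : ℤ_[p]) ^ 6‖₊ : ℝ≥0∞) * volume S := by
  have h4 : (2 : ℤ_[p]) ^ 4 ≠ 0 := pow_ne_zero _ two_ne_zero
  have h6 : (2 : ℤ_[p]) ^ 6 ≠ 0 := pow_ne_zero _ two_ne_zero
  set T : ℤ_[p] × ℤ_[p] →+ ℤ_[p] × ℤ_[p] :=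
    (AddMonoidHom.mulLeft ((2 : ℤ_[p]) ^ 4)).prodMap (AddMonoidHom.mulLeft ((2 : ℤ_[p]) ^ 6)) with hT
  have hTcoe : (T : ℤ_[p] × ℤ_[p] → ℤ_[p] × ℤ_[p]) =
      fun IJ ↦ ((2 : ℤ_[p]) ^ 4 * IJ.1, (2 : ℤ_[p]) ^ 6 * IJ.2) := by
    funext IJ; rfl
  have hcont : Continuous T := by
    rw [hTcoe]; fun_prop
  have hinj : Function.Injective T := by
    rw [hTcoe]
    rintro ⟨a, b⟩ ⟨a', b'⟩ h
    simp only [Prod.mk.injEq] at h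
    exact Prod.ext (mul_right_injective₀ h4 h.1) (mul_right_injective₀ h6 h.2)
  have key := measure_image_addMonoidHom_eq ((volume : Measure ℤ_[p]).prod (volume : Measure ℤ_[p])) T hcont hinj S
  rw [hTcoe, ← Measure.volume_eq_prod] at key
  rw [key]
  congr 1
  have hrange : range (fun IJ : ℤ_[p] × ℤ_[p] ↦ ((2 : ℤ_[p]) ^ 4 * IJ.1, (2 : ℤ_[p]) ^ 6 * IJ.2)) =
      range (fun x : ℤ_[p] ↦ (2 : ℤ_[p]) ^ 4 * x) ×ˢ range (fun x : ℤ_[p] ↦ (2 : ℤ_[p]) ^ 6 * x) := by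
    rw [← range_prodMap]; rfl
  rw [hrange, Measure.volume_eq_prod, Measure.prod_prod, padicInt_volume_range_mulLeft h4,
    padicInt_volume_range_mulLeft h6, ennnorm_eq_inv_pow_valuation h4, ennnorm_eq_inv_pow_valuation h6]

/-! ## §2 The integrand in `[0, ∞]` and its orbit sums -/

/-- The modified weight `Φ = 1_{Δ ≠ 0} · φ_p` in `[0, ∞]` is measurable. [folklore] -/
theorem measurable_ofReal_sievePhi' :
    Measurable fun f : BinaryQuartic ℤ_[p] ↦ ENNReal.ofReal
      (if f.disc ≠ 0 ∧ (f.map PadicInt.Coe.ringHom).IsSoluble ∧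
          (∃ IJ ∈ invariantPairsAdic p, f.I = 2 ^ 4 * IJ.1 ∧ f.J = 2 ^ 6 * IJ.2)
        then (1 : ℝ) / (if f.disc ≠ 0 then localWeight f else 0 : ℕ) else 0) :=
  ENNReal.measurable_ofReal.comp (measurable_sievePhi' p)

/-- The modified weight is `GL₂(ℤ_p)`-invariant. [folklore] -/
theorem sievePhi'_glInt_smul (k : GL (Fin 2) ℤ_[p]) (f : BinaryQuartic ℤ_[p]) :
    (if (k • f).disc ≠ 0 ∧ ((k • f).map PadicInt.Coe.ringHom).IsSoluble ∧
          (∃ IJ ∈ invariantPairsAdic p, (k • f).I = 2 ^ 4 * IJ.1 ∧ (k • f).J = 2 ^ 6 * IJ.2)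
        then (1 : ℝ) / (if (k • f).disc ≠ 0 then localWeight (k • f) else 0 : ℕ) else 0) =
      (if f.disc ≠ 0 ∧ (f.map PadicInt.Coe.ringHom).IsSoluble ∧
          (∃ IJ ∈ invariantPairsAdic p, f.I = 2 ^ 4 * IJ.1 ∧ f.J = 2 ^ 6 * IJ.2)
        then (1 : ℝ) / (if f.disc ≠ 0 then localWeight f else 0 : ℕ) else 0) := by
  simp only [disc_glInt_smul, I_glInt_smul, J_glInt_smul, isSoluble_map_glInt_smul_iff, localWeight_glInt_smul]

/-- Off `Δ = 0` the modified weight in `[0, ∞]` is `1_{soluble} 1_{inv} · m_p⁻¹` (as `m_p ≥ 1`).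
[folklore] -/
theorem ofReal_sievePhi'_eq {f : BinaryQuartic ℤ_[p]} (hΔ : f.disc ≠ 0) :
    ENNReal.ofReal (if f.disc ≠ 0 ∧ (f.map PadicInt.Coe.ringHom).IsSoluble ∧
          (∃ IJ ∈ invariantPairsAdic p, f.I = 2 ^ 4 * IJ.1 ∧ f.J = 2 ^ 6 * IJ.2)
        then (1 : ℝ) / (if f.disc ≠ 0 then localWeight f else 0 : ℕ) else 0) =
      if (f.map PadicInt.Coe.ringHom).IsSoluble ∧
          invPair f ∈ (fun IJ : ℤ_[p] × ℤ_[p] ↦ ((2 : ℤ_[p]) ^ 4 * IJ.1, (2 : ℤ_[p]) ^ 6 * IJ.2)) '' invariantPairsAdic p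
        then ((localWeight f : ℝ≥0∞))⁻¹ else 0 := by
  rw [← exists_invariantPairsAdic_iff_invPair_mem]
  have hm : 0 < localWeight f := one_le_localWeight f (cosets_padic_finite f hΔ)
  simp only [hΔ, ne_eq, not_false_eq_true, true_and, if_true]
  split_ifs with h
  · rw [one_div, ENNReal.ofReal_inv_of_pos (by exact_mod_cast hm), ENNReal.ofReal_natCast]
  · rw [ENNReal.ofReal_zero]

/-- **The orbit sums of `Φ`**: for every `(I', J')`, the orbit sum of `Φ/#Aut_{ℤ_p}` over the orbits
with invariants `(I', J')` is `1_{(I',J') ∈ 2⁴F_p^{inv} × 2⁶F_p^{inv}}` times the orbit sum of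
`1_{soluble}/(m_p #Aut_{ℤ_p})`. [cite: BhargavaShankarAnnals2015, Prop. 5.12 proof (arXiv:1006.1002v2 numbering)] -/
theorem tsum_orbits_sievePhi'_eq (IJ' : ℤ_[p] × ℤ_[p]) :
    (∑' O : {O : Set (BinaryQuartic ℤ_[p]) // ∃ f, f.disc ≠ 0 ∧ invPair f = IJ' ∧ orbit (GL (Fin 2) ℤ_[p]) f = O},
        ⨆ f ∈ (O : Set (BinaryQuartic ℤ_[p])),
          ENNReal.ofReal (if f.disc ≠ 0 ∧ (f.map PadicInt.Coe.ringHom).IsSoluble ∧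
              (∃ IJ ∈ invariantPairsAdic p, f.I = 2 ^ 4 * IJ.1 ∧ f.J = 2 ^ 6 * IJ.2)
            then (1 : ℝ) / (if f.disc ≠ 0 then localWeight f else 0 : ℕ) else 0) / (autCard f : ℝ≥0∞)) =
      ((fun IJ : ℤ_[p] × ℤ_[p] ↦ ((2 : ℤ_[p]) ^ 4 * IJ.1, (2 : ℤ_[p]) ^ 6 * IJ.2)) '' invariantPairsAdic p).indicator
        (fun IJ' ↦ ∑' O : {O : Set (BinaryQuartic ℤ_[p]) // ∃ f, f.disc ≠ 0 ∧ invPair f = IJ' ∧ orbit (GL (Fin 2) ℤ_[p]) f = O},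
          ⨆ f ∈ (O : Set (BinaryQuartic ℤ_[p])),
            (if (f.map PadicInt.Coe.ringHom).IsSoluble then ((localWeight f : ℝ≥0∞))⁻¹ else 0) / (autCard f : ℝ≥0∞))
        IJ' := by
  set D := (fun IJ : ℤ_[p] × ℤ_[p] ↦ ((2 : ℤ_[p]) ^ 4 * IJ.1, (2 : ℤ_[p]) ^ 6 * IJ.2)) '' invariantPairsAdic p with hD
  -- the value of `Φ/#Aut` on the orbit of `f₀`
  have hΨ : ∀ (k : GL (Fin 2) ℤ_[p]) (f : BinaryQuartic ℤ_[p]),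
      ENNReal.ofReal (if (k • f).disc ≠ 0 ∧ ((k • f).map PadicInt.Coe.ringHom).IsSoluble ∧
          (∃ IJ ∈ invariantPairsAdic p, (k • f).I = 2 ^ 4 * IJ.1 ∧ (k • f).J = 2 ^ 6 * IJ.2)
        then (1 : ℝ) / (if (k • f).disc ≠ 0 then localWeight (k • f) else 0 : ℕ) else 0) / (autCard (k • f) : ℝ≥0∞) =
      ENNReal.ofReal (if f.disc ≠ 0 ∧ (f.map PadicInt.Coe.ringHom).IsSoluble ∧
          (∃ IJ ∈ invariantPairsAdic p, f.I = 2 ^ 4 * IJ.1 ∧ f.J = 2 ^ 6 * IJ.2)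
        then (1 : ℝ) / (if f.disc ≠ 0 then localWeight f else 0 : ℕ) else 0) / (autCard f : ℝ≥0∞) := by
    intro k f
    rw [sievePhi'_glInt_smul, autCard_smul]
  by_cases hmem : IJ' ∈ D
  · rw [indicator_of_mem hmem]
    refine tsum_congr fun O ↦ ?_
    obtain ⟨f₀, hΔ₀, hI₀, hO⟩ := O.2
    rw [← hO, iSup_orbit_eq_of_invariant hΨ f₀, iSup_orbit_solubleWeight, ofReal_sievePhi'_eq p hΔ₀, hI₀]
    by_cases hsol : (f₀.map PadicInt.Coe.ringHom).IsSoluble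
    · rw [if_pos ⟨hsol, hmem⟩, if_pos hsol]
    · rw [if_neg (fun h ↦ hsol h.1), if_neg hsol]
  · rw [indicator_of_notMem hmem, ENNReal.tsum_eq_zero]
    intro O
    obtain ⟨f₀, hΔ₀, hI₀, hO⟩ := O.2
    rw [← hO, iSup_orbit_eq_of_invariant hΨ f₀, ofReal_sievePhi'_eq p hΔ₀, hI₀, if_neg (fun h ↦ hmem h.2),
      ENNReal.zero_div]

/-- **The fibre value**: for `(I', J') = (2⁴I, 2⁶J)` with `(I, J) ∈ F_p^{inv}`, `I ≠ 0`, `J ≠ 0`,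
`4I'³ ≠ J'²`, the orbit sum of `1_{soluble}/(m_p #Aut_{ℤ_p})` is the Brumer–Kramer constant `c_p`
(Cor. 3.8, Lemmas 5.10–5.11, Lemma 5.16, and the integrality of `B_p^{I,J}`).
[cite: BhargavaShankarAnnals2015, Prop. 5.12 proof and Lemma 5.16 (arXiv:1006.1002v2 numbering)] -/
theorem tsum_orbits_solubleWeight_eq_const {IJ' : ℤ_[p] × ℤ_[p]}
    (hmem : IJ' ∈ (fun IJ : ℤ_[p] × ℤ_[p] ↦ ((2 : ℤ_[p]) ^ 4 * IJ.1, (2 : ℤ_[p]) ^ 6 * IJ.2)) '' invariantPairsAdic p)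
    (h1 : IJ'.1 ≠ 0) (h2 : IJ'.2 ≠ 0) (hΔ : 4 * IJ'.1 ^ 3 - IJ'.2 ^ 2 ≠ 0) :
    (∑' O : {O : Set (BinaryQuartic ℤ_[p]) // ∃ f, f.disc ≠ 0 ∧ invPair f = IJ' ∧ orbit (GL (Fin 2) ℤ_[p]) f = O},
        ⨆ f ∈ (O : Set (BinaryQuartic ℤ_[p])),
          (if (f.map PadicInt.Coe.ringHom).IsSoluble then ((localWeight f : ℝ≥0∞))⁻¹ else 0) / (autCard f : ℝ≥0∞)) =
      ENNReal.ofReal (if p = 2 then 2 else 1) := by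
  obtain ⟨IJ, hIJ, rfl⟩ := hmem
  have hI : IJ.1 ≠ 0 := by intro h0; apply h1; simp [h0]
  have hJ : IJ.2 ≠ 0 := by intro h0; apply h2; simp [h0]
  have hΔIJ : 4 * IJ.1 ^ 3 - IJ.2 ^ 2 ≠ 0 := by
    intro h0; apply hΔ
    show 4 * ((2 : ℤ_[p]) ^ 4 * IJ.1) ^ 3 - ((2 : ℤ_[p]) ^ 6 * IJ.2) ^ 2 = 0
    linear_combination (2 : ℤ_[p]) ^ 12 * h0
  rw [tsum_orbits_eq_localSelmerRatio hΔ ?_, localSelmerRatio_eq p brumerKramer_card_quotient_two_holds hΔ]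
  intro F hFI hFJ hsol
  exact exists_integral_pgl2Equiv_of_mem_invariantPairsAdic hIJ hI hJ hΔIJ hFI hFJ hsol

/-- The exceptional set of §2 is null: almost every `(I', J') ∈ ℤ_p²` has `I' ≠ 0`, `J' ≠ 0`,
`4I'³ ≠ J'²`. [folklore] -/
theorem ae_generic : ∀ᵐ IJ' : ℤ_[p] × ℤ_[p], IJ'.1 ≠ 0 ∧ IJ'.2 ≠ 0 ∧ 4 * IJ'.1 ^ 3 - IJ'.2 ^ 2 ≠ 0 := by
  have h1 : volume {IJ' : ℤ_[p] × ℤ_[p] | IJ'.1 = 0} = 0 := by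
    have : {IJ' : ℤ_[p] × ℤ_[p] | IJ'.1 = 0} = ({0} : Set ℤ_[p]) ×ˢ (univ : Set ℤ_[p]) := by
      ext ⟨a, b⟩; simp
    rw [this, Measure.volume_eq_prod, Measure.prod_prod, measure_singleton, zero_mul]
  have h2 : volume {IJ' : ℤ_[p] × ℤ_[p] | IJ'.2 = 0} = 0 := by
    have : {IJ' : ℤ_[p] × ℤ_[p] | IJ'.2 = 0} = (univ : Set ℤ_[p]) ×ˢ ({0} : Set ℤ_[p]) := by
      ext ⟨a, b⟩; simp
    rw [this, Measure.volume_eq_prod, Measure.prod_prod, measure_singleton, mul_zero]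
  have h3 := volume_discCurve p
  filter_upwards [measure_eq_zero_iff_ae_notMem.mp h1, measure_eq_zero_iff_ae_notMem.mp h2,
    measure_eq_zero_iff_ae_notMem.mp h3] with IJ' e1 e2 e3
  exact ⟨e1, e2, e3⟩

/-! ## §3 The local density -/

/-- `|2⁴|_p |2⁶|_p / |27|_p = |2¹⁰/3³|_p` (norms of natural numbers in `ℤ_p` are their `p`-adic
absolute values). [folklore] -/
theorem norm_constants :
    ‖(2 : ℤ_[p]) ^ 4‖ * ‖(2 : ℤ_[p]) ^ 6‖ * ‖(27 : ℤ_[p])‖⁻¹ = ((padicNorm p (2 ^ 10 / 3 ^ 3) : ℚ) : ℝ) := by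
  have hnat : ∀ n : ℕ, ‖(n : ℤ_[p])‖ = ((padicNorm p n : ℚ) : ℝ) := by
    intro n
    have hc : ((n : ℤ_[p]) : ℚ_[p]) = ((n : ℚ) : ℚ_[p]) := by push_cast; rfl
    rw [PadicInt.norm_def, hc, Padic.eq_padicNorm]
  have e4 : ‖(2 : ℤ_[p]) ^ 4‖ = ((padicNorm p 16 : ℚ) : ℝ) := by
    rw [show (2 : ℤ_[p]) ^ 4 = ((16 : ℕ) : ℤ_[p]) by norm_num, hnat]; norm_num
  have e6 : ‖(2 : ℤ_[p]) ^ 6‖ = ((padicNorm p 64 : ℚ) : ℝ) := by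
    rw [show (2 : ℤ_[p]) ^ 6 = ((64 : ℕ) : ℤ_[p]) by norm_num, hnat]; norm_num
  have e27 : ‖(27 : ℤ_[p])‖ = ((padicNorm p 27 : ℚ) : ℝ) := by
    rw [show (27 : ℤ_[p]) = ((27 : ℕ) : ℤ_[p]) by norm_num, hnat]; norm_num
  rw [e4, e6, e27, show (2 ^ 10 / 3 ^ 3 : ℚ) = 16 * 64 / 27 by norm_num, padicNorm.div, padicNorm.mul]
  push_cast
  rw [div_eq_mul_inv]

/-- **Bhargava–Shankar, Prop. 5.12 (arXiv v2) = Prop. 3.13 (published), for the family of all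
elliptic curves: `∫_{V_{ℤ_p}} φ_p(f) df = |2¹⁰/3³|_p · M_p(V,F)`**, where
`φ_p(f) = 1/m_p(f)` if `f` is `ℚ_p`-soluble with `(I(f), J(f)) = (2⁴I, 2⁶J)` for some
`(I, J) ∈ F_p^{inv}`, and `0` otherwise, and `M_p(V,F) = localMassV p =
(1 − p⁻²) ∫_{F_p^{inv}} #(E_{I,J}/2E_{I,J})/#E_{I,J}[2] dI dJ`. This is the local input (F) of the
`2`-Selmer sieve (proof of Thm 3.19) in exactly the form taken by
`BinaryQuartic.averageRankLE_three_halves_of_localIntegrals`.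
[cite: BhargavaShankarAnnals2015, Prop. 5.12 (arXiv:1006.1002v2 numbering) = Prop. 3.13 (published numbering)] -/
theorem integral_sievePhi_eq :
    ∫ f : BinaryQuartic ℤ_[p],
        (if (f.map PadicInt.Coe.ringHom).IsSoluble ∧
            (∃ IJ ∈ invariantPairsAdic p, f.I = 2 ^ 4 * IJ.1 ∧ f.J = 2 ^ 6 * IJ.2)
          then (1 : ℝ) / localWeight f else 0) =
      ((padicNorm p (2 ^ 10 / 3 ^ 3) : ℚ) : ℝ) * localMassV p := by
  set D := (fun IJ : ℤ_[p] × ℤ_[p] ↦ ((2 : ℤ_[p]) ^ 4 * IJ.1, (2 : ℤ_[p]) ^ 6 * IJ.2)) '' invariantPairsAdic p with hD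
  set cp : ℝ := if p = 2 then 2 else 1 with hcp
  have hcp0 : 0 ≤ cp := by rw [hcp]; split_ifs <;> norm_num
  -- Step 1: `∫ φ_p = (∫⁻ Φ).toReal`
  have h1 : ∫ f : BinaryQuartic ℤ_[p],
      (if (f.map PadicInt.Coe.ringHom).IsSoluble ∧
          (∃ IJ ∈ invariantPairsAdic p, f.I = 2 ^ 4 * IJ.1 ∧ f.J = 2 ^ 6 * IJ.2)
        then (1 : ℝ) / localWeight f else 0) =
      (∫⁻ f : BinaryQuartic ℤ_[p], ENNReal.ofReal
        (if f.disc ≠ 0 ∧ (f.map PadicInt.Coe.ringHom).IsSoluble ∧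
            (∃ IJ ∈ invariantPairsAdic p, f.I = 2 ^ 4 * IJ.1 ∧ f.J = 2 ^ 6 * IJ.2)
          then (1 : ℝ) / (if f.disc ≠ 0 then localWeight f else 0 : ℕ) else 0)).toReal := by
    rw [integral_congr_ae (sievePhi_ae_eq p)]
    refine integral_eq_lintegral_of_nonneg_ae (Eventually.of_forall fun f ↦ ?_)
      (measurable_sievePhi' p).aestronglyMeasurable
    simp only [Pi.zero_apply]
    positivity
  -- Step 2: the orbit form of the change of measure
  have h2 := lintegral_eq_mul_lintegral_tsum_orbits (measurable_ofReal_sievePhi' p)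
    (fun k f ↦ by rw [sievePhi'_glInt_smul])
  -- Step 3: the fibrewise evaluation
  have hDm : MeasurableSet D := measurableSet_image_invariantPairsAdic p
  have h3 : (∫⁻ IJ' : ℤ_[p] × ℤ_[p],
      ∑' O : {O : Set (BinaryQuartic ℤ_[p]) // ∃ f, f.disc ≠ 0 ∧ invPair f = IJ' ∧ orbit (GL (Fin 2) ℤ_[p]) f = O},
        ⨆ f ∈ (O : Set (BinaryQuartic ℤ_[p])),
          ENNReal.ofReal (if f.disc ≠ 0 ∧ (f.map PadicInt.Coe.ringHom).IsSoluble ∧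
              (∃ IJ ∈ invariantPairsAdic p, f.I = 2 ^ 4 * IJ.1 ∧ f.J = 2 ^ 6 * IJ.2)
            then (1 : ℝ) / (if f.disc ≠ 0 then localWeight f else 0 : ℕ) else 0) / (autCard f : ℝ≥0∞)) =
      ENNReal.ofReal cp * volume D := by
    simp_rw [tsum_orbits_sievePhi'_eq p]
    rw [lintegral_indicator hDm, ← setLIntegral_const]
    refine setLIntegral_congr_fun_ae hDm ?_
    filter_upwards [ae_generic p] with IJ' hgen hmem
    exact tsum_orbits_solubleWeight_eq_const p hmem hgen.1 hgen.2.1 hgen.2.2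
  rw [h1, h2, h3, volume_image_scale]
  -- Step 4: the constants
  have hp : p.Prime := Fact.out
  have hp0 : (p : ℝ) ≠ 0 := by exact_mod_cast hp.ne_zero
  have h27 : ‖(27 : ℤ_[p])‖ ≠ 0 := norm_ne_zero_iff.mpr (by norm_num)
  rw [localMassV_eq p brumerKramer_card_quotient_two_holds, localMassU, invariantPairsAdicClosure_eq,
    ← norm_constants p]
  simp only [ENNReal.toReal_mul, ENNReal.toReal_div, ENNReal.toReal_inv, ENNReal.toReal_pow,
    ENNReal.toReal_natCast, ENNReal.coe_toReal, coe_nnnorm, ENNReal.toReal_ofReal hcp0]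
  have hsub : ((p ^ 2 - 1 : ℕ) : ℝ) = (p : ℝ) ^ 2 - 1 := by
    rw [Nat.cast_sub (Nat.one_le_pow _ _ hp.pos), Nat.cast_pow, Nat.cast_one]
  rw [hsub]
  field_simp
  ring

end BinaryQuartic

/-! ## §4 Cor. 1.2: the discharge of `averageRankLE_three_halves` -/

/-- **Bhargava–Shankar, Cor. 1.2** (discharge of the named fact `averageRankLE_three_halves` of
`BSDWave0.lean`, bsd.S26): when elliptic curves `E/ℚ` (the curves `E_{A,B}`, `p⁴ ∤ A` or `p⁶ ∤ B`,
ordered by `H = max(4|A|³, 27B²)`) are ordered by height, the `limsup` of the average rank of the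
Mordell–Weil groups `E(ℚ)` is at most `3/2`. The tree proves Cor. 1.2 along the printed route —
Thm 1.1 in `limsup` form (`BSDWave0Proofs`, `2r ≤ 2^r ≤ #Sel₂`), Thm 5.6 with the minimisation
lemmas, Props. 5.7–5.8, the upper-bound sieve of §2.7/Thm 2.21 with the congruence counts of
Thm 2.12 for the three real types, Lemmas 5.15–5.16 — up to the local densities (F), taken as the
only hypothesis of `BinaryQuartic.averageRankLE_three_halves_of_localIntegrals`; (F) is
`BinaryQuartic.integral_sievePhi_eq` above. [cite: BhargavaShankarAnnals2015, Cor. 1.2 (p. 3); Prop. 5.12 (arXiv:1006.1002v2 numbering)] -/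
theorem averageRankLE_three_halves_holds : averageRankLE_three_halves :=
  BinaryQuartic.averageRankLE_three_halves_of_localIntegrals
    (fun p _ ↦ BinaryQuartic.integral_sievePhi_eq p)

end Literature.NumberTheory.EllipticCurves

end
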